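import Summits.Ventures.PackingBounds.Configurations.CohnLi

/-!
# `κ(19) ≥ 11948` (Ho 2026, arXiv:2603.10425) — kernel-checked

Framing: lottery ticket; floor = certified bounds/negative ranges. Venture `PackingBounds` (cell
`pub-packcert`, seat `pub-packcert-energy`).

Cohn–Li's `19`-dimensional configuration (`CohnLi.lean`: `684 + 9984` integer vectors plus the sign vectors of a
`1024`-word shortened Golay code) can take the sign vectors of ANY code of minimum distance `≥ 5` (on the `19` kept
coordinates) inside the `5`-punctured Golay code. B. S. Ho (arXiv:2603.10425, March 2026) found such a code with
`1280` words: a union of `20` cosets of a `6`-dimensional subcode `M` (a `5`-coclique of the Clebsch graph on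
`K/M`, times the `4` cosets of `K`). We transport his explicit generators to our Golay model by an isomorphism of
the Steiner systems `S(5,8,24)` mapping his punctured coordinates `20…24` to ours `19…23` (found by a short search;
seat file `code/k19_iso.py`), enter the `20` coset representatives `repW` and `6` generators `mgenW` as codewords,
and let the kernel check: all `1280` words are codewords (`cw_msgA`), and every difference of two of them has
`≥ 5` ones among the kept coordinates unless trivial (`dist_msgA`, `20·20·64` restricted weights). The rest is the
Cohn–Li geometry of `CohnLi.lean`: **`κ(19) ≥ 684 + 9984 + 1280 = 11948`** (`exists_kissing_11948`), the lower
bound of record at the time of writing, with the bracket `11948 ≤ κ(19) ≤ 25900`.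

## References
* B. S. Ho, *A new lower bound for the kissing number in 19 dimensions*, arXiv:2603.10425 (2026). [`Ho2026`]
* H. Cohn, A. Li, *Improved kissing numbers in seventeen through twenty-one dimensions*, arXiv:2411.04916 (2024). [`CohnLi2024`]
-/

namespace Summit.Ventures.PackingBounds.Config.Leech

open Finset Golay

local notation "E24" => EuclideanSpace ℝ (Fin 24)

/-! ### Ho's code `A`, transported to our coordinates -/

/-- The `20` coset representatives (codewords of our Golay model) of Ho's `1280`-word code `A`, transported
from the coordinates of arXiv:2603.10425 §2 by an explicit isomorphism of Steiner systems. [cite: Ho2026, §4 Prop. 9] -/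
def repW (i : ℕ) : ℕ :=
  match i with
  | 0 => 7995969 | 1 => 15991937 | 2 => 15214849 | 3 => 14221337 | 4 => 12453896 | 5 => 13897712
  | 6 => 5900592 | 7 => 4596912 | 8 => 7802280 | 9 => 1050041 | 10 => 1611447 | 11 => 9867383
  | 12 => 9092599 | 13 => 12293359 | 14 => 14458110 | 15 => 11967238 | 16 => 3710406
  | 17 => 2404422 | 18 => 1415518 | 19 => 7508303 | _ => 0

/-- The `6` generators of the subcode `M` (codewords of our Golay model). [cite: Ho2026, §2] -/
def mgenW (i : ℕ) : ℕ :=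
  match i with
  | 0 => 112131 | 1 => 8410412 | 2 => 203538 | 3 => 237898 | 4 => 275738 | 5 => 165530 | _ => 0

/-- `XOR` of the generators of `M` selected by the bits of `m`, using the first `j` generators. -/
def mspanAux : ℕ → ℕ → ℕ
  | 0, _ => 0
  | j + 1, m => (if m.testBit j then mgenW j else 0) ^^^ mspanAux j m

/-- The element of `M` with coordinates `m < 64`. -/
def mspan (m : ℕ) : ℕ := mspanAux 6 m

/-- `mspanAux` is additive. -/
theorem mspanAux_xor (j m m' : ℕ) : mspanAux j (m ^^^ m') = mspanAux j m ^^^ mspanAux j m' := by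
  induction j with
  | zero => simp [mspanAux]
  | succ j ih =>
    simp only [mspanAux, Nat.testBit_xor, ih]
    cases m.testBit j <;> cases m'.testBit j <;> simp [Nat.xor_assoc, Nat.xor_left_comm]

/-- `mspan` is additive. -/
theorem mspan_xor (m m' : ℕ) : mspan (m ^^^ m') = mspan m ^^^ mspan m' := mspanAux_xor 6 m m'

/-- The codeword of `A` with index `(i, m)`. -/
def cwA (i m : ℕ) : ℕ := repW i ^^^ mspan m

/-- Its message (our encoding is systematic). -/
def msgA (i m : ℕ) : ℕ := cwA i m % 4096

set_option maxRecDepth 100000 in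
/-- Every word of `A` is a codeword of our Golay model: `cw (msgA i m) = cwA i m`. [cite: Ho2026, §2 Prop. 2] -/
theorem cw_msgA : ∀ i < 20, ∀ m < 64, cw (msgA i m) = cwA i m := by
  decide +kernel

/-- Bit count of `w` on the coordinates `t < k` with `t < n` (a kernel-cheap form of `wtK`). -/
def popK (n : ℕ) : ℕ → ℕ → ℕ
  | 0, _ => 0
  | k + 1, w => popK n k w + (if k < n ∧ w.testBit k = true then 1 else 0)

/-- `popK` counts the filtered range. -/
theorem card_filter_range_eq_popK (n w : ℕ) :
    ∀ k, ((range k).filter fun t => t < n ∧ w.testBit t = true).card = popK n k w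
  | 0 => by simp [popK]
  | k + 1 => by
    rw [range_add_one, filter_insert, popK]
    split_ifs with h
    · rw [card_insert_of_notMem (by simp), card_filter_range_eq_popK n w k]
    · rw [card_filter_range_eq_popK n w k, add_zero]

/-- The restricted weight as a bit count. -/
theorem wtK_eq_popK (n w : ℕ) : wtK n w = popK n 24 w := by
  rw [← card_filter_range_eq_popK]
  unfold wtK
  have : (univ.filter fun j : Fin 24 => j.val < n ∧ w.testBit j.val = true) =
      ((range 24).filter fun t => t < n ∧ w.testBit t = true).attachFin
        (fun t ht => mem_range.mp (mem_filter.mp ht).1) := by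
    ext j; simp [Finset.mem_attachFin]
  rw [this, Finset.card_attachFin]

set_option maxRecDepth 100000 in
set_option maxHeartbeats 2000000 in
/-- **Minimum distance `5` on the kept coordinates** (kernel check over the `210 · 64` coset differences):
every difference of two words of `A` has at least `5` ones among the coordinates `< 19`, unless it is trivial.
[cite: Ho2026, §4 Prop. 9] -/
theorem dist_msgA_le : ∀ i < 20, ∀ j < 20, ∀ m < 64,
    j < i ∨ (i = j ∧ m = 0) ∨ 5 ≤ popK 19 24 (repW i ^^^ repW j ^^^ mspan m) := by
  decide +kernel

/-- Minimum distance `5`, all ordered pairs, in terms of `wtK`. -/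
theorem dist_msgA : ∀ i < 20, ∀ j < 20, ∀ m < 64, (i = j ∧ m = 0) ∨ 5 ≤ wtK 19 (repW i ^^^ repW j ^^^ mspan m) := by
  intro i hi j hj m hm
  rw [wtK_eq_popK]
  rcases le_total i j with hij | hji
  · rcases dist_msgA_le i hi j hj m hm with h | h
    · omega
    · exact h
  · rcases dist_msgA_le j hj i hi m hm with h | ⟨rfl, h0⟩ | h
    · omega
    · exact Or.inl ⟨rfl, h0⟩
    · right; rwa [Nat.xor_comm (repW j) (repW i)] at h

/-- Differences inside `A`. -/
theorem cwA_xor (i j m m' : ℕ) : cwA i m ^^^ cwA j m' = repW i ^^^ repW j ^^^ mspan (m ^^^ m') := by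
  unfold cwA; rw [mspan_xor]
  simp only [Nat.xor_assoc, Nat.xor_left_comm, Nat.xor_comm]

/-- Two words that `XOR` to `0` are equal. -/
theorem eq_of_xor_eq_zero {m m' : ℕ} (h : m ^^^ m' = 0) : m = m' := by
  have e : m = (m ^^^ m') ^^^ m' := by rw [Nat.xor_assoc, Nat.xor_self, Nat.xor_zero]
  rw [h, Nat.zero_xor] at e
  exact e

/-! ### The sign part built on `A` -/

/-- The `1280` sign vectors on the `19` kept coordinates. -/
noncomputable def setS19 : Finset (Fin 24 → ℤ) :=
  ((range 20) ×ˢ (range 64)).image fun p => svec 19 (msgA p.1 p.2)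

attribute [irreducible] setS19

/-- Members of the sign part. -/
theorem mem_setS19 {x : Fin 24 → ℤ} (hx : x ∈ setS19) : ∃ i < 20, ∃ m < 64, x = svec 19 (msgA i m) := by
  rw [setS19] at hx
  simp only [mem_image, mem_product, mem_range, Prod.exists] at hx
  obtain ⟨i, m, ⟨hi, hm⟩, rfl⟩ := hx
  exact ⟨i, hi, m, hm, rfl⟩

/-- Messages are `< 4096`. -/
theorem msgA_lt (i m : ℕ) : msgA i m < 4096 := Nat.mod_lt _ (by norm_num)

/-- Restricted weight of the difference of two distinct words of `A` is `≥ 5`. -/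
theorem wtK_msgA {i j m m' : ℕ} (hi : i < 20) (hj : j < 20) (hm : m < 64) (hm' : m' < 64)
    (hne : msgA i m ≠ msgA j m') : 5 ≤ wtK 19 (cw (msgA i m ^^^ msgA j m')) := by
  rw [cw_xor, cw_msgA i hi m hm, cw_msgA j hj m' hm', cwA_xor]
  have hmm : m ^^^ m' < 64 := by
    have := Nat.xor_lt_two_pow (n := 6) (by simpa using hm) (by simpa using hm'); simpa using this
  rcases dist_msgA i hi j hj (m ^^^ m') hmm with ⟨rfl, h0⟩ | h
  · exact absurd (by rw [eq_of_xor_eq_zero h0]) hne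
  · exact h

/-- `|setS19| = 1280`: `(i, m) ↦ svec 19 (msgA i m)` is injective on the index box. -/
theorem card_setS19 : setS19.card = 1280 := by
  rw [setS19, card_image_of_injOn]
  · simp
  rintro ⟨i, m⟩ hp ⟨j, m'⟩ hp' h
  simp only [coe_product, Set.mem_prod, coe_range, Set.mem_Iio] at hp hp'
  have hmsg := svec_inj (n := 19) (by norm_num) (by norm_num) (msgA_lt i m) (msgA_lt j m') h
  have hcw : cwA i m ^^^ cwA j m' = 0 := by
    rw [← cw_msgA i hp.1 m hp.2, ← cw_msgA j hp'.1 m' hp'.2, hmsg, Nat.xor_self]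
  rw [cwA_xor] at hcw
  have hmm : m ^^^ m' < 64 := by
    have := Nat.xor_lt_two_pow (n := 6) (by simpa using hp.2) (by simpa using hp'.2); simpa using this
  rcases dist_msgA i hp.1 j hp'.1 (m ^^^ m') hmm with ⟨rfl, h0⟩ | h5
  · rw [eq_of_xor_eq_zero h0]
  · rw [hcw] at h5; simp [wtK] at h5

/-- **Sign part pairwise**: `2 · ip ≤ 19`. -/
theorem two_ip_le_of_mem_setS19 {s s' : Fin 24 → ℤ} (hs : s ∈ setS19) (hs' : s' ∈ setS19) (hne : s ≠ s') :
    2 * ip s s' ≤ 19 := by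
  obtain ⟨i, hi, m, hm, rfl⟩ := mem_setS19 hs
  obtain ⟨j, hj, m', hm', rfl⟩ := mem_setS19 hs'
  have hmsg : msgA i m ≠ msgA j m' := fun h => hne (by rw [h])
  have h5 := wtK_msgA hi hj hm hm' hmsg
  have := ip_svec_svec_le (n := 19) (by norm_num) (u := msgA i m) (u' := msgA j m') (w := 5) h5
  omega

/-- Norm `19`. -/
theorem ip_self_of_mem_setS19 {s : Fin 24 → ℤ} (hs : s ∈ setS19) : ip s s = 19 := by
  obtain ⟨i, _, m, _, rfl⟩ := mem_setS19 hs
  exact ip_svec_self (by norm_num) _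

/-- Integer part against sign part: `ip ≤ 12`. -/
theorem ip_le_of_mem_clInt_setS19 {x s : Fin 24 → ℤ} (hx : x ∈ clInt 19) (hs : s ∈ setS19) : ip x s ≤ 12 := by
  obtain ⟨i, _, m, _, rfl⟩ := mem_setS19 hs
  rcases mem_clInt hx with ⟨k, l, a, b, hkl, _, rfl⟩ | ⟨o, v, _, hO, rfl⟩
  · exact (ip_avec_svec_le hkl a b 19 _).trans (by norm_num)
  · exact ip_bvecOdd_svec_le o v hO (msgA_lt i m)

/-! ### The configuration in `ℝ²⁴` and its transfer to `ℝ¹⁹` -/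

/-- Ho's `11948`-point configuration inside `ℝ²⁴` (integer part scaled by `1/√32`, sign part by `1/√19`). -/
noncomputable def conf19 : Finset E24 := (clInt 19).image (toE 32) ∪ setS19.image (toE 19)

/-- The two parts are disjoint. -/
theorem disjoint_conf19 : Disjoint ((clInt 19).image (toE 32)) (setS19.image (toE (19 : ℝ))) := by
  rw [Finset.disjoint_left]
  intro p hp hq
  obtain ⟨x, hx, rfl⟩ := mem_image.mp hp
  obtain ⟨s, hs, he⟩ := mem_image.mp hq
  obtain ⟨i, _, m, _, rfl⟩ := mem_setS19 hs
  have e0 := congrArg (fun v : E24 => v 0) he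
  simp only [toE_apply] at e0
  have hs0 : svec 19 (msgA i m) 0 = 1 ∨ svec 19 (msgA i m) 0 = -1 := by
    rcases svec_apply_cases 19 (msgA i m) 0 with ⟨_, h⟩ | ⟨h, _⟩
    · exact h
    · exact absurd (by decide) h
  have hx0 := apply_cases_of_mem_clInt hx 0
  have hsq : (Real.sqrt (19 : ℝ))⁻¹ ^ 2 * (svec 19 (msgA i m) 0 : ℝ) ^ 2 = (Real.sqrt 32)⁻¹ ^ 2 * (x 0 : ℝ) ^ 2 := by
    have := congrArg (fun t : ℝ => t ^ 2) e0; simpa [mul_pow] using this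
  rw [inv_pow, inv_pow, Real.sq_sqrt (by norm_num), Real.sq_sqrt (by norm_num)] at hsq
  have hs1 : (svec 19 (msgA i m) 0 : ℝ) ^ 2 = 1 := by rcases hs0 with h | h <;> rw [h] <;> norm_num
  rw [hs1, mul_one] at hsq
  have key : (x 0 : ℝ) ^ 2 * 19 = 32 := by
    field_simp at hsq
    linarith
  have key' : (x 0) ^ 2 * (19 : ℤ) = 32 := by exact_mod_cast key
  rcases hx0 with h | h | h | h | h <;> rw [h] at key' <;> omega

/-- `|conf19| = 684 + 9984 + 1280 = 11948`. -/
theorem card_conf19 : conf19.card = 11948 := by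
  rw [conf19, card_union_eq_card_add_card.mpr disjoint_conf19,
    card_image_of_injective _ (toE_injective (by norm_num)), card_image_of_injective _ (toE_injective (by norm_num)),
    card_clInt, card_idxAn.1, card_octIn.1, card_setS19]

/-- Unit vectors. -/
theorem norm_conf19 : ∀ p ∈ conf19, ‖p‖ = 1 := by
  intro p hp
  rw [conf19, mem_union] at hp
  rcases hp with hp | hp
  · obtain ⟨x, hx, rfl⟩ := mem_image.mp hp
    exact norm_toE (by norm_num) (by rw [ip_self_of_mem_clInt hx]; norm_num)
  · obtain ⟨s, hs, rfl⟩ := mem_image.mp hp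
    exact norm_toE (by norm_num) (by rw [ip_self_of_mem_setS19 hs]; norm_num)

/-- **Pairwise inner products `≤ 1/2`.** -/
theorem inner_conf19 : ∀ a ∈ conf19, ∀ b ∈ conf19, a ≠ b → inner ℝ a b ≤ 1 / 2 := by
  intro a ha b hb hab
  rw [conf19, mem_union] at ha hb
  rcases ha with ha | ha <;> rcases hb with hb | hb
  · obtain ⟨x, hx, rfl⟩ := mem_image.mp ha
    obtain ⟨y, hy, rfl⟩ := mem_image.mp hb
    have hxy : x ≠ y := fun h => hab (by rw [h])
    rw [inner_toE (by norm_num), div_le_iff₀ (by norm_num)]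
    have : (ip x y : ℝ) ≤ 16 := by exact_mod_cast ip_le_of_mem_clInt hx hy hxy
    linarith
  · obtain ⟨x, hx, rfl⟩ := mem_image.mp ha
    obtain ⟨s, hs, rfl⟩ := mem_image.mp hb
    rw [inner_toE_toE (by norm_num) (by norm_num)]
    exact twelve_div_le (n := 19) (by norm_num) (by exact_mod_cast ip_le_of_mem_clInt_setS19 hx hs)
  · obtain ⟨s, hs, rfl⟩ := mem_image.mp ha
    obtain ⟨x, hx, rfl⟩ := mem_image.mp hb
    rw [inner_toE_toE (by norm_num) (by norm_num), mul_comm, ip_comm]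
    exact twelve_div_le (n := 19) (by norm_num) (by exact_mod_cast ip_le_of_mem_clInt_setS19 hx hs)
  · obtain ⟨s, hs, rfl⟩ := mem_image.mp ha
    obtain ⟨s', hs', rfl⟩ := mem_image.mp hb
    have hss : s ≠ s' := fun h => hab (by rw [h])
    rw [inner_toE (by norm_num), div_le_iff₀ (by norm_num)]
    have : (2 : ℝ) * (ip s s' : ℝ) ≤ 19 := by exact_mod_cast two_ip_le_of_mem_setS19 hs hs' hss
    linarith

/-- The configuration is orthogonal to `e_j`, `j ≥ 19`. -/
theorem inner_single_conf19 {j : Fin 24} (hj : ¬ j.val < 19) :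
    ∀ p ∈ conf19, inner ℝ (EuclideanSpace.single j (1 : ℝ)) p = 0 := by
  intro p hp
  rw [EuclideanSpace.inner_single_left, map_one, one_mul]
  rw [conf19, mem_union] at hp
  rcases hp with hp | hp
  · obtain ⟨x, hx, rfl⟩ := mem_image.mp hp
    rw [toE_apply, apply_eq_zero_of_mem_clInt hx hj]; simp
  · obtain ⟨s, hs, rfl⟩ := mem_image.mp hp
    obtain ⟨i, _, m, _, rfl⟩ := mem_setS19 hs
    rw [toE_apply]; simp [svec, hj]

/-- **`κ(19) ≥ 11948`** (Ho 2026): a kissing configuration of `11948` unit vectors in `ℝ¹⁹`. [cite: Ho2026, Theorem 1] -/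
theorem exists_kissing_11948 : ∃ C : Finset (EuclideanSpace ℝ (Fin 19)),
    C.card = 11948 ∧ (∀ x ∈ C, ‖x‖ = 1) ∧ (∀ x ∈ C, ∀ y ∈ C, x ≠ y → inner ℝ x y ≤ 1 / 2) := by
  obtain ⟨C', hc, hno, hi, _⟩ := exists_transfer_orthogonal (m := 24) (n := 19) (k := 5) (by norm_num)
    (fun i : Fin 5 => EuclideanSpace.single (⟨19 + i.val, by omega⟩ : Fin 24) (1 : ℝ))
    (linearIndependent_tail 19 5 (by norm_num)) conf19 (fun x hx i => inner_single_conf19 (by simp) x hx)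
  refine ⟨C', by rw [hc, card_conf19], fun x' hx' => ?_, fun x' hx' y' hy' hne => ?_⟩
  · obtain ⟨x, hx, he⟩ := hno x' hx'
    rw [he]; exact norm_conf19 x hx
  · obtain ⟨x, hx, y, hy, hxy, he⟩ := hi x' hx' y' hy' hne
    rw [he]; exact inner_conf19 x hx y hy hxy

/-- **`11948 ≤ κ(19) ≤ 25900` in Lean.** [cite: Ho2026, Theorem 1] -/
theorem kissing_dim19_ho_bracket :
    (∃ C : Finset (EuclideanSpace ℝ (Fin 19)), C.card = 11948 ∧ (∀ x ∈ C, ‖x‖ = 1) ∧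
      (∀ x ∈ C, ∀ y ∈ C, x ≠ y → inner ℝ x y ≤ 1 / 2)) ∧
    ∀ C : Finset (EuclideanSpace ℝ (Fin 19)), (∀ x ∈ C, ‖x‖ = 1) →
      (∀ x ∈ C, ∀ y ∈ C, x ≠ y → inner ℝ x y ≤ 1 / 2) → C.card ≤ 25900 :=
  ⟨exists_kissing_11948, Kissing.kissing_dim19_le_25900⟩

end Summit.Ventures.PackingBounds.Config.Leech
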